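import Summits.CriticalPhenomena.CardyFormulaZ2.Theses.CardyUniqueLimit
import Summits.CriticalPhenomena.CardyFormulaZ2.Theorems.CardyUniqueLimitCardyRigidityDefs
import Summits.CriticalPhenomena.CardyFormulaZ2.Theorems.CardyUniqueLimitCardyRigidityStubKernelFacts
import Summits.CriticalPhenomena.CardyFormulaZ2.Theorems.CardyUniqueLimitCardyRigidityMvpRigidity
import Literature.Analysis.Complex.HydrodynamicExpansion
import HarnessLib

/-!
# Line `exit_hull_farfield` for crux `CardyRigidity` (stmt-CriticalPhenomena-0746) — skeleton v1

Strategist `planner-cstrat-stmt-CriticalPhenomena-0746-s1-0` (crux-strategist, ALTERNATIVE line; the live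
line is `Lines/crossing_martingale.lean`, lead `line-stmt-CriticalPhenomena-0746-c3`, untouched).

Crux (verbatim, nine route files): `∀ f, (∀ R, R.HasCrossingLimit (bondDomainCrossingProb R) f) →
EqOn f cardyFunction (Ioo 0 1)`.

## The cut: ONE stopping time, far marks, no Loewner chain

The live line realises the kernel `f` as a CROSSING MARTINGALE in continuous Loewner time along
subsequential scaling limits of the bond-`ℤ²` exploration interface; its open stubs are the
Kemppainen–Smirnov inputs A1 (`PercFaceBoxTight`, blocked on the Literature named fact
`exists_regularity_of_conditionG2`), A2‴ (annulus transfer) and the heart A3b (slit observable ≈ kernel,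
uniformly in Loewner time).  This line deletes the curve-level scaling limit altogether:

* explore the interface of a fixed Dobrushin domain from its first marked point `a` ONLY UNTIL THE FIRST
  EXIT of a small ball `B(a, r₀)` (one stopping step `N` of the discrete exploration filtration);
* the domain Markov property at `N` and the all-rectangle hypothesis — used ONCE for the fixed crossing
  event `Q_x` of the rectangle with three far marks `Φ(-xᵢ)` on the wired arc and ONCE, through a finite
  net of sandwiching Jordan rectangles, for the random slit rectangles at the exit step — give the
  ONE-STEP MEAN-VALUE IDENTITY `E_δ f(η(Xᵈ)) → f(η(x))` (`δ → 0`), where `Xᵈᵢ = W - G(-xᵢ)`,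
  `G` = reflected mapping-out function of the conformal image of the explored hull (a half-plane hull
  inside a fixed half-disc `B̄(0, ρ)`), `W = G(tip)`; this for ALL far mark triples with ONE hull law
  (the exploration does not see the marks).  The laws of `(G|_{|z|>ρ}, W, hcap)` are trivially tight
  (hydrodynamic maps of hulls in a fixed ball: `|G z - z| ≤ 4 hcap/|z|`), so NO tightness of interfaces,
  NO driving function, NO capacity clock is needed; RSW enters only as `E_δ hcap ≥ h₀ > 0`;
* FAR FIELD: sending the marks to `∞` at fixed shape `n·(a,b,c)`, the tree's expansion
  `|G z - z - hcap/z| ≤ 6·hcap·ρ/|z|²` (`Literature.Analysis.Complex.IsHydrodynamicAt.norm_sub_sub_div_le'`)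
  turns the identity into the asymptotic mean-value data of the LANDED analysis half
  `CrossingMartingale.Mvp.affineCardy_of_mvpData` (p149898…: `m ≠ 0` or `v = 0` ⇒ `f` constant;
  else two mark shapes per modulus pin `v = 6` and Cardy's ODE), after normalising `E hcap = 2` by a
  dilation; the landed `stub_kernelFacts` (p145789) pins the affine constants by the boundary values.

## Stubs (3) and composition

* `stub_exitHullData` (P, the percolation heart + RSW non-degeneracy, XL): `AllRectangleKernel f →
  ExitHullData f`;
* `stub_normalise` (S, M): dilation + Bolzano–Weierstrass: `ExitHullData f → NormalisedExitHullData f`;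
* `stub_mvpData` (N, L): weak subsequential limits of the increment laws on `[-rₙ, rₙ]` + the far-field
  expansion: `ContinuousOn f (Ioo 0 1) → NormalisedExitHullData f → ∃ m v, 0 ≤ v ∧ MvpData f m v`;
* `CardyRigidity_of` — PROVED below from the three stubs, `stub_kernelFacts` and
  `Mvp.affineCardy_of_mvpData`, concluding the crux BY NAME.

Orientation (tree conventions, cf. `Cruxes/CardyRigidity/SEAT-B.md`): `bondInterfaceIn` has the wired arc
`A` on its LEFT; marks `uᵢ = Φ(-xᵢ)` lie on `A`; the fixed event is the free crossing
`darc(u₂,u₁) ↔ darc(u₀,a)`; given the prefix its conditional probability is the slit crossing towards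
`darc(u₀,a) ∪ left bank` (landed `…SlitCrossingEventIdentity.lean`), a 4-arc crossing of
`(ℍ ∖ K; G(-x₂), G(-x₁), G(-x₀), W)` with modulus `cardyEta X₀ X₁ X₂`, `Xᵢ = W - G(-xᵢ)`.

Disproof.lean (cdisprove v1.5) honoured: `crux_false_without_H` — H is used in P (twice) and in
`stub_kernelFacts`; (d) `IsProbabilityMeasure` is a field of the data; (e) constant kernels pass every
mean-value identity, so N only concludes the AFFINE form and the boundary values pin it; §5 (two shapes
per modulus pin `κ = 6` and `a = 2/3` simultaneously) is exactly the mechanism of `Mvp`.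
-/

noncomputable section

open MeasureTheory Filter Set Topology
open scoped NNReal ENNReal
open Literature.Probability.RandomPlanarGeometry
open Literature.Analysis.Complex (IsHydrodynamicAt hcapAt)
open Summit.CriticalPhenomena.CardyFormulaZ2.Cruxes.CardyRigidity.CrossingMartingale

namespace Summit.CriticalPhenomena.CardyFormulaZ2.Cruxes.CardyRigidity.ExitHullFarField

/-! ### §0 Vocabulary (sorry-free): exit-hull ensembles and their mean-value property -/

/-- **Exit-hull ensemble** along a sequence (index `k` ↔ mesh `δₖ → 0`) on one measurable space: for
each `k` and sample `ω`, `G k ω` is a hydrodynamically normalised symmetric map outside `B̄(0, ρ)` (the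
Schwarz reflection of the mapping-out function `g_K` of a half-plane hull `K ⊆ B̄(0, ρ)`,
`Literature.Analysis.Complex.IsHydrodynamicAt`), `A k ω = hcapAt (G k ω) 0` its half-plane capacity and
`w k ω` a real number (the image of the tip), both bounded by `C`, all measurable in `ω` (evaluations of
`G` at real points off the ball included). [cite: Lawler2005, §3.4] -/
structure IsExitHullEnsemble {Ω : Type*} [MeasurableSpace Ω] (ρ C : ℝ) (G : ℕ → Ω → ℂ → ℂ)
    (w A : ℕ → Ω → ℝ) : Prop where
  pos : 0 < ρ
  hydro : ∀ k ω, IsHydrodynamicAt (G k ω) 0 ρ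
  hcap_eq : ∀ k ω, hcapAt (G k ω) 0 = A k ω
  hcap_le : ∀ k ω, A k ω ≤ C
  abs_tip_le : ∀ k ω, |w k ω| ≤ C
  measurable_tip : ∀ k, Measurable (w k)
  measurable_hcap : ∀ k, Measurable (A k)
  measurable_eval : ∀ k (x : ℝ), ρ < |x| → Measurable fun ω ↦ (G k ω x).re

/-- The modulus of the slit rectangle with far marks `-x₂ < -x₁ < -x₀ < 0` on the wired (left) arc:
`cardyEta X₀ X₁ X₂` with `Xᵢ = w - Re G(-xᵢ)` (for the empty hull, `G = id`, `w = 0`, it is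
`cardyEta x₀ x₁ x₂`). [cite: Werner2007, §3] -/
def slitEta {Ω : Type*} (G : ℕ → Ω → ℂ → ℂ) (w : ℕ → Ω → ℝ) (k : ℕ) (ω : Ω) (x₀ x₁ x₂ : ℝ) : ℝ :=
  cardyEta (w k ω - (G k ω (-(x₀ : ℂ))).re) (w k ω - (G k ω (-(x₁ : ℂ))).re)
    (w k ω - (G k ω (-(x₂ : ℂ))).re)

/-- **One-step mean-value property** of the kernel `f` along the ensemble: for every mark triple beyond
`R₀`, `E f(η(slit marks)) → f(η(marks))` as `k → ∞` (domain Markov property at the exit step + the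
all-rectangle hypothesis for the fixed event and for the slit rectangles). [cite: CamiaNewman2007, §5, Thm 3] -/
def HasExitMeanValue {Ω : Type*} [MeasurableSpace Ω] (f : ℝ → ℝ) (μ : Measure Ω)
    (G : ℕ → Ω → ℂ → ℂ) (w : ℕ → Ω → ℝ) (R₀ : ℝ) : Prop :=
  ∀ x₀ x₁ x₂ : ℝ, R₀ ≤ x₀ → x₀ < x₁ → x₁ < x₂ →
    Tendsto (fun k ↦ ∫ ω, f (slitEta G w k ω x₀ x₁ x₂) ∂μ) atTop (𝓝 (f (cardyEta x₀ x₁ x₂)))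

/-- **Exit-hull data for the kernel `f`**: a probability space with an exit-hull ensemble whose mean
half-plane capacity stays bounded below (RSW: the exit hull is not flat) and which has the one-step
mean-value property for `f`. [cite: CamiaNewman2007, §5] -/
def ExitHullData (f : ℝ → ℝ) : Prop :=
  ∃ (Ω : Type) (_ : MeasurableSpace Ω) (μ : Measure Ω) (_ : IsProbabilityMeasure μ) (ρ C R₀ : ℝ)
    (G : ℕ → Ω → ℂ → ℂ) (w A : ℕ → Ω → ℝ),
    IsExitHullEnsemble ρ C G w A ∧ (∃ h₀ : ℝ, 0 < h₀ ∧ ∀ᶠ k in atTop, h₀ ≤ ∫ ω, A k ω ∂μ) ∧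
      HasExitMeanValue f μ G w R₀

/-- **Normalised exit-hull data**: as `ExitHullData`, with convergent first moments, the mean capacity
normalised to `2` (`= 2t` at Loewner time `t = 1`), and convergent mean and second moment of the tip.
[cite: LawlerSchrammWerner2001, §3] -/
def NormalisedExitHullData (f : ℝ → ℝ) : Prop :=
  ∃ (Ω : Type) (_ : MeasurableSpace Ω) (μ : Measure Ω) (_ : IsProbabilityMeasure μ) (ρ C R₀ : ℝ)
    (G : ℕ → Ω → ℂ → ℂ) (w A : ℕ → Ω → ℝ) (mw v : ℝ),
    IsExitHullEnsemble ρ C G w A ∧ HasExitMeanValue f μ G w R₀ ∧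
      Tendsto (fun k ↦ ∫ ω, A k ω ∂μ) atTop (𝓝 2) ∧
      Tendsto (fun k ↦ ∫ ω, w k ω ∂μ) atTop (𝓝 mw) ∧
      Tendsto (fun k ↦ ∫ ω, (w k ω) ^ 2 ∂μ) atTop (𝓝 v)

/-- **The asymptotic mean-value data** of `CrossingMartingale.Mvp.affineCardy_of_mvpData` (its
hypothesis `hdata`, verbatim): for every shape `0 < a < b < c`, probability laws `νₙ` on `[-rₙ, rₙ]`,
`rₙ → 0`, with `∫ f(η̂ + x) dνₙ = f η̂` exactly and the three moment asymptotics with constants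
`(m, v)`. [cite: LawlerSchrammWerner2001, §3] -/
def MvpData (f : ℝ → ℝ) (m v : ℝ) : Prop :=
  ∀ a b c : ℝ, 0 < a → a < b → b < c →
      ∃ (r : ℕ → ℝ) (ν : ℕ → Measure ℝ) (L₁ L₂ M₁ : ℝ), Tendsto r atTop (𝓝 0) ∧
        (∀ᶠ n in atTop, IsProbabilityMeasure (ν n) ∧ ν n (Icc (-(r n)) (r n))ᶜ = 0 ∧
          ∫ x, f (cardyEta a b c + x) ∂(ν n) = f (cardyEta a b c)) ∧
        Tendsto (fun n : ℕ ↦ (n : ℝ) * ∫ x, x ∂(ν n)) atTop (𝓝 L₁) ∧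
        Tendsto (fun n : ℕ ↦ (n : ℝ) ^ 2 * ∫ x, x ^ 2 ∂(ν n)) atTop (𝓝 L₂) ∧
        (m = 0 → Tendsto (fun n : ℕ ↦ (n : ℝ) ^ 2 * ∫ x, x ∂(ν n)) atTop (𝓝 M₁)) ∧
        L₁ = -((c - b) * (b - a) / ((c - a) * b ^ 2)) * m ∧
        L₂ = ((c - b) * (b - a) / ((c - a) * b ^ 2)) ^ 2 * v ∧
        M₁ = 2 * (a⁻¹ + b⁻¹ + c⁻¹) * ((c - b) * (b - a) / ((c - a) * b ^ 2)) +
            v / 2 * (-2 * ((c - b) * (b - a)) / ((c - a) * b ^ 3))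

/-! ### §1 Sanity lemmas (sorry-free): the vocabulary is not vacuous -/

/-- The empty hull: `G = id`, `w = 0` has slit modulus `cardyEta x₀ x₁ x₂`. [folklore] -/
theorem slitEta_id {Ω : Type*} (k : ℕ) (ω : Ω) (x₀ x₁ x₂ : ℝ) :
    slitEta (fun _ _ z ↦ z) (fun _ _ ↦ (0 : ℝ)) k ω x₀ x₁ x₂ = cardyEta x₀ x₁ x₂ := by
  simp [slitEta]

/-! ### §2 The registered stubs -/

/-- **STUB P (the percolation heart; XL).**  For a kernel with the all-rectangle property there are
exit-hull data: realised by the bond-`ℤ²` exploration of a fixed nice Dobrushin domain (e.g. the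
oriented certified disc family `OrientedDisc.exists_oriented_family`) stopped at the first exit of a
small ball about the starting point, `G` = Schwarz reflection of the hydrodynamic map of the filled
conformal image of the explored polyline (`exists_isHydrodynamicMap_hpFill`, `reflExt`), `w` = image of
the tip, `A = hcap`; the mean-value property from the domain Markov property at the exit step
(`percSlitExpectation`, `condExp_explorationFiltration_ae_eq_percSlitExpectation`, the landed event
identity `…SlitCrossingEventIdentity`), HYP for the fixed far rectangles, and HYP transported to the
random slit rectangles at ONE stopping time through a finite net of sandwiching Jordan rectangles
(outer domains for the primal and, by discrete duality, the dual event; tip/fjord negligibility: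
landed `…SlitCrossingTipNegligible`, `…Bulk`, `…Flower`); `E hcap ≥ h₀` by RSW (the interface leaves
the half-ball through its top sector with probability `≥ p₀`, and `hcap ≥ c·height²`).
Why it might fail: only through a mis-typed field of `IsExitHullEnsemble` (measurability of the
evaluations, the sure bound on `w`) — the mathematics is Camia–Newman's Theorem 3 at a single stopping
time. [cite: CamiaNewman2007, §5, Thm 3] [cite: Smirnov2001, §2] -/
theorem stub_exitHullData : ∀ f : ℝ → ℝ, AllRectangleKernel f → ExitHullData f := by
  sorry

/-- **STUB S (normalisation; M).**  Bolzano–Weierstrass for the three bounded moment sequences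
`E A_k ∈ [h₀, C]`, `E w_k`, `E w_k² ∈ [-C, C²]` along a common subsequence, then the dilation
`G ↦ λ G(·/λ)`, `w ↦ λ w`, `A ↦ λ² A`, `ρ ↦ λ ρ`, `R₀ ↦ λ R₀` with `λ² · lim E A = 2`
(`IsHydrodynamicAt` and `hcapAt` scale, `cardyEta` is dilation invariant: `FarField.cardyEta_mul`).
[cite: Lawler2005, §3.4] -/
theorem stub_normalise : ∀ f : ℝ → ℝ, ExitHullData f → NormalisedExitHullData f := by
  sorry

/-- **STUB N (far-field packaging; L).**  For a shape `0 < a < b < c` and scale `n`, let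
`Dₙᵏ = slitEta G w k · (na) (nb) (nc) - cardyEta a b c`.  By `IsHydrodynamicAt.norm_sub_sub_div_le'`,
`G(-n xᵢ) = -n xᵢ - A/(n xᵢ) + O(C ρ/n²)`, so `Xᵢ/n = xᵢ + (A/n²)/xᵢ + w/n + O(n⁻³)` surely and
(`FarField.abs_cardyEta_perturbed_sub_le`) `|Dₙᵏ| ≤ r n := C'/n`,
`E Dₙᵏ = S₁ E wₖ/n + (S₁Σ E Aₖ - (S₁/b) E wₖ²)/n² + O(n⁻³)`, `E (Dₙᵏ)² = S₁² E wₖ²/n² + O(n⁻³)`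
uniformly in `k`.  Take `νₙ` = a weak subsequential limit (`k → ∞`; probability laws on the compact
`[-rₙ, rₙ]`) of the laws of `Dₙᵏ`: the mean-value property and the continuity of `f` near
`cardyEta a b c` give `∫ f(η̂ + x) dνₙ = f η̂` exactly, and the displayed moments give `MvpData f m v`
with `m = -mw`, `v = lim E wₖ² ≥ 0` (`E A → 2`). [cite: LawlerSchrammWerner2001, §3] [cite: Lawler2005, Prop. 3.46] -/
theorem stub_mvpData : ∀ f : ℝ → ℝ, ContinuousOn f (Ioo 0 1) → NormalisedExitHullData f →
    ∃ m v : ℝ, 0 ≤ v ∧ MvpData f m v := by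
  sorry

/-! ### §3 Composition: the three stubs imply the crux BY NAME -/

/-- **The skeleton theorem.**  STUBS P, S, N with the landed `stub_kernelFacts` (p145789) and
`Mvp.affineCardy_of_mvpData` imply `CardyRigidity` (stmt-CriticalPhenomena-0746).
[cite: CamiaNewman2007, §5] [cite: LawlerSchrammWerner2001, §3] -/
theorem CardyRigidity_of (hP : type_of% @stub_exitHullData) (hS : type_of% @stub_normalise)
    (hN : type_of% @stub_mvpData) :
    Summit.CriticalPhenomena.CardyFormulaZ2.Theses.CardyUniqueLimit.CardyRigidity := by
  intro f hf
  -- landed STUB D: kernel facts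
  obtain ⟨hcont, hf0, hf1⟩ := stub_kernelFacts f hf
  -- P, S, N: the asymptotic mean-value data of `f`
  obtain ⟨m, v, hv, hdata⟩ := hN f hcont (hS f (hP f hf))
  -- the landed analysis half: `f = A I_{2/3} + B` on (0,1)
  obtain ⟨A, B, hfab⟩ := Mvp.affineCardy_of_mvpData hcont hv hdata
  -- the boundary values of `f` along the affine form: `B = 0`, `A = 1`
  have hev0 : ∀ᶠ η in 𝓝[>] (0 : ℝ), f η = A * betaLaw (2 / 3) η + B :=
    Filter.eventually_of_mem (Ioo_mem_nhdsGT zero_lt_one) fun η hη ↦ hfab hη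
  have hev1 : ∀ᶠ η in 𝓝[<] (1 : ℝ), f η = A * betaLaw (2 / 3) η + B :=
    Filter.eventually_of_mem (Ioo_mem_nhdsLT zero_lt_one) fun η hη ↦ hfab hη
  have hlim0 : Tendsto f (𝓝[>] 0) (𝓝 (A * 0 + B)) :=
    ((tendsto_betaLaw_two_thirds_zero.const_mul A).add_const B).congr'
      (hev0.mono fun η hη ↦ hη.symm)
  have hlim1 : Tendsto f (𝓝[<] 1) (𝓝 (A * 1 + B)) :=
    ((tendsto_betaLaw_two_thirds_one.const_mul A).add_const B).congr'
      (hev1.mono fun η hη ↦ hη.symm)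
  have hB0 : B = 0 := by
    have := tendsto_nhds_unique hlim0 hf0
    simpa using this
  have hA1 : A = 1 := by
    have := tendsto_nhds_unique hlim1 hf1
    rw [hB0] at this
    simpa using this
  -- conclusion: `f = I_{2/3} = F` on (0,1)
  intro η hη
  have hfη : f η = A * betaLaw (2 / 3) η + B := hfab hη
  rw [hfη, hA1, hB0, one_mul, add_zero, betaLaw_two_thirds]
  exact (cardyFunction_eq_incBeta13_div_holds η (Ioo_subset_Icc_self hη)).symm

/-- The composition applied to the registered stubs (the only `sorry`s of this file). [folklore] -/
theorem cardyRigidity_of_stubs :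
    Summit.CriticalPhenomena.CardyFormulaZ2.Theses.CardyUniqueLimit.CardyRigidity :=
  CardyRigidity_of stub_exitHullData stub_normalise stub_mvpData

end Summit.CriticalPhenomena.CardyFormulaZ2.Cruxes.CardyRigidity.ExitHullFarField

end
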